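import Literature.Analysis.Fourier.BoasKacSmooth
import Mathlib.Analysis.Fourier.PoissonSummation
import HarnessLib

/-!
# Boas–Kac (Kreĭn) factorisation of a positive definite function of compact support, I: the lattice

**Theorem** (Boas–Kac 1945, Thm 1; Kreĭn 1940; the form proved in `BoasKacNonneg.lean`).  A smooth
`k : ℝ → ℂ` with `tsupport k ⊆ [-2a, 2a]` whose Fourier transform is pointwise a nonnegative real,
`𝓕 k ξ ≥ 0`, is ONE autocorrelation `f ⋆ f̃` of a smooth `f` with `tsupport f ⊆ [-a, a]`.

The tree already proves (files `BoasKacFourierSide.lean`, `BoasKacSmooth.lean`) that finite SUMS of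
autocorrelations are autocorrelations, by discretisation on the lattice `hℤ`, the Fejér–Riesz theorem
and a weak limit.  The present two files run the same pipeline with ONE new front end, proved here:
with `k_s = k(· - 2a)` (supported in `[0, 4a]`), mesh `h = 4a/(2n+2)` (so `(n+1)h = 2a`) and the sample
polynomial `P(z) = Σ_{j ≤ 2n+2} k_s(jh) z^j` (`LatticeStep.samplePoly`), for `z = e^{-2πihξ}`

  `conj z^{n+1} · P(z) = Σ_{m ∈ ℤ} k(mh) e^{-2πi m h ξ} = (1/h) Σ_{m ∈ ℤ} 𝓕 k (ξ + m/h) ≥ 0`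

by POISSON SUMMATION (Mathlib `SchwartzMap.tsum_eq_tsum_fourier`) applied to the Schwartz function
`x ↦ k(hx) e^{-2πi x hξ}`, whose Fourier transform at `η` is `(1/h) 𝓕 k (ξ + η/h)`
(`fourier_dilate_modulate`).  Hence the Fejér–Riesz theorem (`FejerRiesz.exists_eq_mul_conjReverse`)
factors `(1/h) P = q · conjReverse (n+1) q` (`exists_factor`), and the lattice step function
`f_n = latticeStep h q` (`LatticeStep.latticeStep`) satisfies EXACTLY
`‖𝓕 f_n ξ‖² = (1/h) conj(c_h(ξ)) · conj z^{n+1} · 𝓕 S_n(ξ)` (`S_n` the step function of the samples of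
`k_s`, `c_h(ξ) = ∫₀ʰ e^{-2πiyξ}dy`; `ofReal_norm_sq_fourier_latticeStep`) and `‖f_n‖₂² = Re k(0)`
(`integral_norm_sq_latticeStep_factor`), whence `‖𝓕 f_n ξ‖² → Re 𝓕 k ξ`
(`tendsto_norm_sq_fourier_latticeStep_factor`: `c_h/h → 1`, `conj z^{n+1} = e^{2πi·2aξ}` and
`𝓕 S_n → 𝓕 k_s = e^{-2πi·2aξ} 𝓕 k` by the tree's `BoasKac.tendsto_fourier_sampleStep`).
The weak limit and the smooth representative are taken in `BoasKacNonneg.lean`.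

## References

* R. P. Boas, M. Kac, *Inequalities for Fourier transforms of positive functions*, Duke Math. J. 12
  (1945), Thm 1. [cite: BoasKac1945, Thm 1]
* M. G. Kreĭn, *Sur le problème du prolongement des fonctions hermitiennes positives et continues*,
  Doklady 26 (1940), 17–22.
-/

noncomputable section

open Polynomial Filter MeasureTheory Set FourierTransform
open _root_.Complex _root_.Real
open scoped ComplexConjugate ComplexOrder Topology ContDiff

namespace Literature.Analysis.Fourier.BoasKacNonneg

open Literature.Analysis.Fourier.FejerRiesz Literature.Analysis.Fourier.LatticeStep
  Literature.Analysis.Fourier.BoasKac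

variable {a : ℝ} {k : ℝ → ℂ}

/-! ## Mesh bookkeeping: `h_n = 4a/(2n+2)`, `(n+1) h_n = 2a` -/

/-- The mesh of the `n`-th discretisation, `h_n = mesh (4a) (2n+1) = 2a/(n+1)`. [folklore] -/
theorem mesh_four_mul (a : ℝ) (n : ℕ) : mesh (4 * a) (2 * n + 1) = 2 * a / ((n : ℝ) + 1) := by
  unfold mesh
  have h1 : ((2 * n + 1 : ℕ) : ℝ) + 1 = 2 * ((n : ℝ) + 1) := by push_cast; ring
  rw [h1]
  field_simp
  ring

/-- `(n+1) h_n = 2a`: the half-lattice `{0, h, …, (n+1)h}` ends exactly at `2a`. [folklore] -/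
theorem succ_mul_mesh (a : ℝ) (n : ℕ) : ((n : ℝ) + 1) * mesh (4 * a) (2 * n + 1) = 2 * a := by
  rw [mesh_four_mul]
  field_simp

/-- `h_n → 0` (the index `2n+1 → ∞`). [folklore] -/
theorem tendsto_mesh_four_mul (a : ℝ) : Tendsto (fun n : ℕ => mesh (4 * a) (2 * n + 1)) atTop (𝓝 0) :=
  (tendsto_mesh (4 * a)).comp (tendsto_atTop_mono (fun n : ℕ => show n ≤ 2 * n + 1 by omega) tendsto_id)

/-! ## The Poisson side -/

/-- Fourier transform of the dilated–modulated function `x ↦ k(hx) e^{-2πi x hξ}` (`h > 0`):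
`𝓕(…)(η) = (1/h) 𝓕 k (ξ + η/h)` (substitute `u = hx`). [folklore] -/
theorem fourier_dilate_modulate {h : ℝ} (hh : 0 < h) (k : ℝ → ℂ) (ξ η : ℝ) :
    𝓕 (fun x : ℝ => k (h * x) * cexp (↑(2 * π * (-(x * (h * ξ)))) * I)) η =
      ((h⁻¹ : ℝ) : ℂ) * 𝓕 k (ξ + η / h) := by
  rw [Real.fourier_real_eq, Real.fourier_real_eq]
  have key : (fun v : ℝ => 𝐞 (-(v * η)) • (k (h * v) * cexp (↑(2 * π * (-(v * (h * ξ)))) * I)))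
      = fun v : ℝ => (fun u : ℝ => (𝐞 (-(u * (ξ + η / h))) • k u)) (h * v) := by
    funext v
    simp only [Circle.smul_def, smul_eq_mul, Real.fourierChar_apply]
    rw [mul_comm (k (h * v)) (cexp _), ← mul_assoc, ← Complex.exp_add]
    congr 2
    push_cast
    field_simp
    ring
  rw [key, Measure.integral_comp_mul_left (fun u : ℝ => (𝐞 (-(u * (ξ + η / h))) • k u)) h,
    abs_of_pos (inv_pos.2 hh), Complex.real_smul]

/-- **Poisson summation for the dilated–modulated samples.** For `k` smooth of compact support,
`h > 0`, a real `ξ` and an integer base point `m₀`,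
`Σ_{m ∈ ℤ} k(h(m₀+m)) e^{-2πi (m₀+m) hξ} = (1/h) Σ_{m ∈ ℤ} 𝓕 k (ξ + m/h)`
(Mathlib's `SchwartzMap.tsum_eq_tsum_fourier` for `x ↦ k(hx)e^{-2πi x hξ}`). [folklore] -/
theorem tsum_dilate_modulate_eq {h : ℝ} (hh : 0 < h) (hk : ContDiff ℝ ∞ k)
    (hkc : HasCompactSupport k) (ξ : ℝ) (m₀ : ℤ) :
    ∑' m : ℤ, k (h * ((m₀ : ℝ) + m)) * cexp (↑(2 * π * (-(((m₀ : ℝ) + m) * (h * ξ)))) * I) =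
      ∑' m : ℤ, ((h⁻¹ : ℝ) : ℂ) * 𝓕 k (ξ + m / h) := by
  set F : ℝ → ℂ := fun x => k (h * x) * cexp (↑(2 * π * (-(x * (h * ξ)))) * I) with hF
  have hFs : ContDiff ℝ ∞ F := by
    have h1 : ContDiff ℝ ∞ (fun x : ℝ => ((2 * π * (-(x * (h * ξ))) : ℝ) : ℂ)) :=
      Complex.ofRealCLM.contDiff.comp (contDiff_const.mul (contDiff_id.mul contDiff_const).neg)
    exact (hk.comp (contDiff_const.mul contDiff_id)).mul (h1.mul contDiff_const).cexp
  have hFc : HasCompactSupport F := by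
    refine HasCompactSupport.mul_right ?_
    have e : (fun x : ℝ => k (h * x)) = k ∘ (Homeomorph.mulLeft₀ h hh.ne') := rfl
    rw [e]
    exact hkc.comp_homeomorph _
  have hP := (hFc.toSchwartzMap hFs).tsum_eq_tsum_fourier (m₀ : ℝ)
  have h0 : ((m₀ : ℝ) : UnitAddCircle) = 0 := (AddCircle.coe_eq_zero_iff (1 : ℝ)).2 ⟨m₀, by simp⟩
  simp only [h0, fourier_eval_zero, mul_one, SchwartzMap.fourier_coe] at hP
  have hP' : ∑' n : ℤ, F ((m₀ : ℝ) + n) = ∑' n : ℤ, 𝓕 F n := hP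
  simp only [hF] at hP'
  rw [hP']
  exact tsum_congr fun m => fourier_dilate_modulate hh k ξ m

/-! ## The sample polynomial on the unit circle -/

/-- `conj e^{-2πihξ} = e^{2πihξ}`. [folklore] -/
theorem conj_latticePoint (h ξ : ℝ) : conj (latticePoint h ξ) = cexp (↑(2 * π * (h * ξ)) * I) := by
  rw [latticePoint, ← Complex.exp_conj, map_mul, Complex.conj_ofReal, Complex.conj_I]
  congr 1
  push_cast
  ring

/-- `conj z ^ m * z ^ j = e^{-2πi (j - m) hξ}` for `z = e^{-2πihξ}`. [folklore] -/
theorem conj_latticePoint_pow_mul_pow (h ξ : ℝ) (m j : ℕ) :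
    conj (latticePoint h ξ) ^ m * latticePoint h ξ ^ j =
      cexp (↑(2 * π * (-(((j : ℝ) - m) * (h * ξ)))) * I) := by
  rw [conj_latticePoint, latticePoint, ← Complex.exp_nat_mul, ← Complex.exp_nat_mul, ← Complex.exp_add]
  congr 1
  push_cast
  ring

/-- `conj z ^ m = e^{2πi m hξ}`; with `(n+1)h = 2a` this is the constant `e^{2πi·2aξ}`. [folklore] -/
theorem conj_latticePoint_pow (h ξ : ℝ) (m : ℕ) :
    conj (latticePoint h ξ) ^ m = cexp (↑(2 * π * ((m : ℝ) * h * ξ)) * I) := by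
  rw [conj_latticePoint, ← Complex.exp_nat_mul]
  congr 1
  push_cast
  ring

/-- **The sample sum on the circle is a lattice sum of `k`.**  If `k` vanishes off `[-2a, 2a]` and
`(n+1)h = 2a`, then for `P = Σ_{j ≤ 2n+2} k(jh - 2a) X^j` and `z = e^{-2πihξ}`:
`conj z^{n+1} P(z) = Σ_{m ∈ ℤ} k(h(m - (n+1))) e^{-2πi (m - (n+1)) hξ}`. [folklore] -/
theorem conj_pow_mul_eval_samplePoly {h : ℝ} (hh : 0 < h) (n : ℕ) (hn : ((n : ℝ) + 1) * h = 2 * a)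
    (hka : ∀ x, 2 * a < |x| → k x = 0) (ξ : ℝ) :
    conj (latticePoint h ξ) ^ (n + 1) *
        (samplePoly h (2 * n + 1 + 1) (fun x => k (x - 2 * a))).eval (latticePoint h ξ) =
      ∑' m : ℤ, k (h * ((((-(n + 1 : ℤ)) : ℤ) : ℝ) + m)) *
        cexp (↑(2 * π * (-(((((-(n + 1 : ℤ)) : ℤ) : ℝ) + m) * (h * ξ)))) * I) := by
  rw [eval_eq_sum_range' (lt_of_le_of_lt (natDegree_samplePoly_le _ _ _) (Nat.lt_succ_self _)),
    Finset.mul_sum]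
  symm
  rw [tsum_eq_sum (s := (Finset.range (2 * n + 1 + 1 + 1)).image (Nat.cast : ℕ → ℤ))]
  · rw [Finset.sum_image (fun x _ y _ hxy => by exact_mod_cast hxy)]
    refine Finset.sum_congr rfl fun j hj => ?_
    rw [coeff_samplePoly_of_le (Nat.lt_succ_iff.mp (Finset.mem_range.mp hj)),
      show (starRingEnd ℂ) (latticePoint h ξ) ^ (n + 1) * (k (↑j * h - 2 * a) * latticePoint h ξ ^ j) =
        k (↑j * h - 2 * a) * ((starRingEnd ℂ) (latticePoint h ξ) ^ (n + 1) * latticePoint h ξ ^ j) by ring,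
      conj_latticePoint_pow_mul_pow]
    congr 2
    · push_cast
      rw [← hn]
      ring
    · congr 1
      push_cast
      ring
  · intro m hm
    have hm' : m + 1 ≤ 0 ∨ (2 * n + 1 + 1 + 1 : ℤ) ≤ m := by
      by_contra hcon
      simp only [not_or, not_le] at hcon
      apply hm
      refine Finset.mem_image.2 ⟨m.toNat, Finset.mem_range.2 ?_, Int.toNat_of_nonneg (by omega)⟩
      omega
    rw [hka, zero_mul]
    push_cast
    have h2 : ((n : ℝ) + 1 + 1) * h = 2 * a + h := by rw [← hn]; ring
    rcases hm' with hm' | hm'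
    · have hmr : (m : ℝ) + 1 ≤ 0 := by exact_mod_cast hm'
      refine lt_abs.2 (Or.inr ?_)
      have : ((n : ℝ) + 1 + 1) * h ≤ -(h * (-((n : ℝ) + 1) + m)) := by nlinarith
      linarith
    · have hmr : (2 * n + 1 + 1 + 1 : ℝ) ≤ m := by exact_mod_cast hm'
      refine lt_abs.2 (Or.inl ?_)
      have : ((n : ℝ) + 1 + 1) * h ≤ h * (-((n : ℝ) + 1) + m) := by nlinarith
      linarith

/-- **Nonnegativity on the lattice (Poisson summation).**  For `k` smooth with
`tsupport k ⊆ [-2a, 2a]`, `(n+1)h = 2a`, `P = Σ_{j ≤ 2n+2} k(jh - 2a) X^j` and `z = e^{-2πihξ}`: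
`conj z^{n+1} P(z) = (1/h) Σ_{m ∈ ℤ} 𝓕 k (ξ + m/h)`. [cite: BoasKac1945, Thm 1 (proof, lattice step)] -/
theorem conj_pow_mul_eval_samplePoly_eq_tsum_fourier {h : ℝ} (hh : 0 < h) (hk : ContDiff ℝ ∞ k)
    (hkc : HasCompactSupport k) (hka : ∀ x, 2 * a < |x| → k x = 0) (n : ℕ)
    (hn : ((n : ℝ) + 1) * h = 2 * a) (ξ : ℝ) :
    conj (latticePoint h ξ) ^ (n + 1) *
        (samplePoly h (2 * n + 1 + 1) (fun x => k (x - 2 * a))).eval (latticePoint h ξ) =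
      ∑' m : ℤ, ((h⁻¹ : ℝ) : ℂ) * 𝓕 k (ξ + m / h) := by
  rw [conj_pow_mul_eval_samplePoly hh n hn hka ξ, tsum_dilate_modulate_eq hh hk hkc ξ (-(n + 1 : ℤ))]

/-- Every point of the unit circle is a lattice point `e^{-2πihξ}` (`h ≠ 0`). [folklore] -/
theorem exists_latticePoint_eq {h : ℝ} (hh : h ≠ 0) {z : ℂ} (hz : ‖z‖ = 1) :
    ∃ ξ : ℝ, latticePoint h ξ = z := by
  refine ⟨-(arg z) / (2 * π * h), ?_⟩
  rw [latticePoint]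
  have e : 2 * π * (-(h * (-arg z / (2 * π * h)))) = arg z := by
    field_simp
  rw [e]
  have := Complex.norm_mul_exp_arg_mul_I z
  rwa [hz, Complex.ofReal_one, one_mul] at this

/-- **Fejér–Riesz hypothesis.**  Under `𝓕 k ≥ 0` (pointwise, as a nonnegative real in `ℂ`),
`0 ≤ conj z^{n+1} P(z)` for EVERY `z` on the unit circle. [cite: BoasKac1945, Thm 1 (proof, lattice step)] -/
theorem nonneg_conj_pow_mul_eval_samplePoly {h : ℝ} (hh : 0 < h) (hk : ContDiff ℝ ∞ k)
    (hkc : HasCompactSupport k) (hka : ∀ x, 2 * a < |x| → k x = 0) (hpos : ∀ ξ, 0 ≤ 𝓕 k ξ)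
    (n : ℕ) (hn : ((n : ℝ) + 1) * h = 2 * a) {z : ℂ} (hz : ‖z‖ = 1) :
    0 ≤ conj z ^ (n + 1) * (samplePoly h (2 * n + 1 + 1) (fun x => k (x - 2 * a))).eval z := by
  obtain ⟨ξ, rfl⟩ := exists_latticePoint_eq hh.ne' hz
  rw [conj_pow_mul_eval_samplePoly_eq_tsum_fourier hh hk hkc hka n hn ξ]
  exact tsum_nonneg fun m => mul_nonneg (Complex.zero_le_real.2 (by positivity)) (hpos _)

/-- **The Fejér–Riesz factor of the renormalised sample polynomial**: there is `q` with
`natDegree q ≤ n+1` and `(1/h) P = q · conjReverse (n+1) q`. [cite: Fejer1916, §1] -/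
theorem exists_factor {h : ℝ} (hh : 0 < h) (hk : ContDiff ℝ ∞ k) (hkc : HasCompactSupport k)
    (hka : ∀ x, 2 * a < |x| → k x = 0) (hpos : ∀ ξ, 0 ≤ 𝓕 k ξ) (n : ℕ)
    (hn : ((n : ℝ) + 1) * h = 2 * a) :
    ∃ q : ℂ[X], q.natDegree ≤ n + 1 ∧
      C (((h⁻¹ : ℝ)) : ℂ) * samplePoly h (2 * n + 1 + 1) (fun x => k (x - 2 * a)) =
        q * conjReverse (n + 1) q := by
  refine exists_eq_mul_conjReverse (n + 1) _ ?_ fun z hz => ?_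
  · calc (C (((h⁻¹ : ℝ)) : ℂ) * samplePoly h (2 * n + 1 + 1) (fun x => k (x - 2 * a))).natDegree
        ≤ (samplePoly h (2 * n + 1 + 1) (fun x => k (x - 2 * a))).natDegree := natDegree_C_mul_le _ _
      _ ≤ 2 * n + 1 + 1 := natDegree_samplePoly_le _ _ _
      _ = 2 * (n + 1) := by ring
  · rw [eval_mul, eval_C, mul_left_comm]
    exact mul_nonneg (Complex.zero_le_real.2 (by positivity))
      (nonneg_conj_pow_mul_eval_samplePoly hh hk hkc hka hpos n hn hz)

/-! ## The lattice step function of the factor -/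

/-- **The approximant carries the lattice density exactly**: if `(1/h) P = q · conjReverse (n+1) q`
then `‖𝓕 (latticeStep h q) ξ‖² = (1/h) · conj c_h(ξ) · conj z^{n+1} · 𝓕 S (ξ)`, `S` the lattice step
function of the samples (`𝓕 S = c_h · P(z)`, `LatticeStep.fourier_latticeStep`). [folklore] -/
theorem ofReal_norm_sq_fourier_latticeStep {h : ℝ} (hh : 0 < h) (n : ℕ) {q : ℂ[X]}
    (hq : q.natDegree ≤ n + 1)
    (hPq : C (((h⁻¹ : ℝ)) : ℂ) * samplePoly h (2 * n + 1 + 1) (fun x => k (x - 2 * a)) =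
      q * conjReverse (n + 1) q) (ξ : ℝ) :
    ((‖𝓕 (latticeStep h q) ξ‖ ^ 2 : ℝ) : ℂ) =
      ((h⁻¹ : ℝ) : ℂ) * conj (cellChar h ξ) * (conj (latticePoint h ξ) ^ (n + 1) *
        𝓕 (latticeStep h (samplePoly h (2 * n + 1 + 1) (fun x => k (x - 2 * a)))) ξ) := by
  have h1 := normSq_fourier_latticeStep hh hq ξ
  rw [← hPq, eval_mul, eval_C, normSq_eq_norm_sq] at h1
  rw [h1, fourier_latticeStep hh (natDegree_samplePoly_le _ _ _) ξ, normSq_eq_conj_mul_self]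
  ring

/-- **`L²` norm of the approximant**: `∫ ‖latticeStep h q‖² = Re k(0)` (`= h · Σ |q_j|²`, the middle
coefficient of `(1/h) P`, which is `(1/h) k_s((n+1)h) = (1/h) k(0)`). [folklore] -/
theorem integral_norm_sq_latticeStep_factor {h : ℝ} (hh : 0 < h) (n : ℕ)
    (hn : ((n : ℝ) + 1) * h = 2 * a) {q : ℂ[X]} (hq : q.natDegree ≤ n + 1)
    (hPq : C (((h⁻¹ : ℝ)) : ℂ) * samplePoly h (2 * n + 1 + 1) (fun x => k (x - 2 * a)) =
      q * conjReverse (n + 1) q) :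
    ∫ x, ‖latticeStep h q x‖ ^ 2 = (k 0).re := by
  have e : ((n + 1 : ℕ) : ℝ) * h - 2 * a = 0 := by push_cast; rw [← hn]; ring
  rw [integral_norm_sq_latticeStep hh hq, sum_norm_sq_coeff_eq_re_coeff, ← hPq, coeff_C_mul,
    coeff_samplePoly_of_le (by omega)]
  rw [Complex.re_ofReal_mul, e]
  field_simp

/-- The approximant vanishes off `[0, 2a + h)`. [folklore] -/
theorem latticeStep_factor_eq_zero {h : ℝ} (hh : 0 < h) (n : ℕ) (hn : ((n : ℝ) + 1) * h = 2 * a)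
    {q : ℂ[X]} (hq : q.natDegree ≤ n + 1) {x : ℝ} (hx : x ∉ Ico 0 (2 * a + h)) :
    latticeStep h q x = 0 := by
  refine latticeStep_eq_zero_of_not_mem hh hq fun hx' => hx ⟨hx'.1, ?_⟩
  have e : (((n + 1 : ℕ) : ℝ) + 1) * h = 2 * a + h := by push_cast; rw [← hn]; ring
  rw [← e]
  exact hx'.2

/-! ## Convergence of the lattice densities -/

/-- `‖c_h(ξ)/h - 1‖ ≤ 2π|ξ| h`: the cell character integral is `h + O(h²)`. [folklore] -/
theorem norm_inv_mul_cellChar_sub_one_le {h : ℝ} (hh : 0 < h) (ξ : ℝ) :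
    ‖((h⁻¹ : ℝ) : ℂ) * cellChar h ξ - 1‖ ≤ 2 * π * |ξ| * h := by
  have h1 : cellChar h ξ - h = ∫ y in (0 : ℝ)..h, (cexp (↑(2 * π * (-(y * ξ))) * I) - 1) := by
    rw [intervalIntegral.integral_sub ((Continuous.intervalIntegrable (by fun_prop) _ _))
      intervalIntegrable_const, intervalIntegral.integral_const, sub_zero, cellChar,
      Complex.real_smul, mul_one]
  have h2 : ‖cellChar h ξ - h‖ ≤ (2 * π * |ξ| * h) * |h - 0| := by
    rw [h1]
    refine intervalIntegral.norm_integral_le_of_norm_le_const fun y hy => ?_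
    rw [Set.uIoc_of_le hh.le] at hy
    have hy' : |y| ≤ h := by rw [abs_of_pos hy.1]; exact hy.2
    calc ‖cexp (↑(2 * π * (-(y * ξ))) * I) - 1‖ = ‖cexp (I * ↑(2 * π * (-(y * ξ)))) - 1‖ := by
          rw [mul_comm]
      _ ≤ ‖(2 * π * (-(y * ξ)) : ℝ)‖ := Real.norm_exp_I_mul_ofReal_sub_one_le
      _ = 2 * π * (|y| * |ξ|) := by
          rw [Real.norm_eq_abs, abs_mul, abs_neg, abs_of_pos (by positivity : (0 : ℝ) < 2 * π), abs_mul]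
      _ ≤ 2 * π * (h * |ξ|) := by gcongr
      _ = 2 * π * |ξ| * h := by ring
  calc ‖((h⁻¹ : ℝ) : ℂ) * cellChar h ξ - 1‖ = ‖((h⁻¹ : ℝ) : ℂ) * (cellChar h ξ - h)‖ := by
        congr 1
        rw [mul_sub]
        congr 1
        push_cast
        rw [inv_mul_cancel₀ (Complex.ofReal_ne_zero.2 hh.ne')]
    _ = h⁻¹ * ‖cellChar h ξ - h‖ := by
        rw [norm_mul, Complex.norm_real, Real.norm_eq_abs, abs_of_pos (inv_pos.2 hh)]
    _ ≤ h⁻¹ * ((2 * π * |ξ| * h) * |h - 0|) := by gcongr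
    _ = 2 * π * |ξ| * h := by rw [sub_zero, abs_of_pos hh]; field_simp

/-- `c_{h_n}(ξ)/h_n → 1` along the meshes. [folklore] -/
theorem tendsto_inv_mul_cellChar (a ξ : ℝ) (ha : 0 < a) :
    Tendsto (fun n : ℕ => (((mesh (4 * a) (2 * n + 1))⁻¹ : ℝ) : ℂ) * cellChar (mesh (4 * a) (2 * n + 1)) ξ)
      atTop (𝓝 1) := by
  have h4 : 0 < 4 * a := by positivity
  have hb : Tendsto (fun n : ℕ => 2 * π * |ξ| * mesh (4 * a) (2 * n + 1)) atTop (𝓝 (2 * π * |ξ| * 0)) :=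
    (tendsto_mesh_four_mul a).const_mul _
  rw [mul_zero] at hb
  have h0 := squeeze_zero_norm (fun n => norm_inv_mul_cellChar_sub_one_le (mesh_pos h4 (2 * n + 1)) ξ) hb
  simpa using h0.add_const 1

/-- Fourier transform of a translate: `𝓕 (k(· - c)) ξ = e^{-2πi cξ} 𝓕 k ξ`. [folklore] -/
theorem fourier_comp_sub (k : ℝ → ℂ) (c ξ : ℝ) :
    𝓕 (fun x => k (x - c)) ξ = cexp (↑(2 * π * (-(c * ξ))) * I) * 𝓕 k ξ := by
  rw [Real.fourier_real_eq, Real.fourier_real_eq, ← integral_const_mul,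
    ← integral_sub_right_eq_self (μ := volume) (fun v : ℝ => cexp (↑(2 * π * (-(c * ξ))) * I) *
      (𝐞 (-(v * ξ)) • k v)) c]
  refine integral_congr_ae (Eventually.of_forall fun v => ?_)
  simp only [Circle.smul_def, smul_eq_mul, Real.fourierChar_apply]
  rw [← mul_assoc, ← Complex.exp_add]
  congr 2
  push_cast
  ring

/-- **Convergence of the lattice densities**: if `q_n` is the Fejér–Riesz factor at mesh
`h_n = 4a/(2n+2)` then `‖𝓕 (latticeStep h_n q_n) ξ‖² → Re 𝓕 k ξ` for every `ξ`
(`c_h/h → 1`, `conj z^{n+1} = e^{2πi·2aξ}`, `𝓕 S_n ξ → 𝓕 k_s ξ = e^{-2πi·2aξ} 𝓕 k ξ`).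
[cite: BoasKac1945, Thm 1 (proof, limit step)] -/
theorem tendsto_norm_sq_fourier_latticeStep_factor (ha : 0 < a) (hkcont : Continuous k)
    (hka : ∀ x, 2 * a < |x| → k x = 0) (q : ℕ → ℂ[X]) (hq : ∀ n, (q n).natDegree ≤ n + 1)
    (hPq : ∀ n, C ((((mesh (4 * a) (2 * n + 1))⁻¹ : ℝ)) : ℂ) *
      samplePoly (mesh (4 * a) (2 * n + 1)) (2 * n + 1 + 1) (fun x => k (x - 2 * a)) =
        q n * conjReverse (n + 1) (q n)) (ξ : ℝ) :
    Tendsto (fun n => ‖𝓕 (latticeStep (mesh (4 * a) (2 * n + 1)) (q n)) ξ‖ ^ 2) atTop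
      (𝓝 ((𝓕 k ξ).re)) := by
  have h4 : 0 < 4 * a := by positivity
  set ks : ℝ → ℂ := fun x => k (x - 2 * a) with hks
  have hks_cont : Continuous ks := hkcont.comp (continuous_id.sub continuous_const)
  have hks_supp : ∀ x ∉ Icc 0 (4 * a), ks x = 0 := by
    intro x hx
    refine hka _ (lt_abs.2 ?_)
    rcases lt_or_ge x 0 with h0 | h0
    · exact Or.inr (by linarith)
    · exact Or.inl (by
        have : 4 * a < x := not_le.mp fun h' => hx ⟨h0, h'⟩
        linarith)
  -- the three factors
  have hS : Tendsto (fun n => 𝓕 (latticeStep (mesh (4 * a) (2 * n + 1))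
      (samplePoly (mesh (4 * a) (2 * n + 1)) (2 * n + 1 + 1) ks)) ξ) atTop (𝓝 (𝓕 ks ξ)) :=
    (tendsto_fourier_sampleStep h4 (g := fun _ : Unit => ks) () hks_cont hks_supp ξ).comp
      (tendsto_atTop_mono (fun n : ℕ => show n ≤ 2 * n + 1 by omega) tendsto_id)
  have hZ : ∀ n : ℕ, conj (latticePoint (mesh (4 * a) (2 * n + 1)) ξ) ^ (n + 1) =
      cexp (↑(2 * π * (2 * a * ξ)) * I) := by
    intro n
    rw [conj_latticePoint_pow]
    congr 3
    push_cast
    rw [← succ_mul_mesh a n]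
  have hC : Tendsto (fun n : ℕ => (((mesh (4 * a) (2 * n + 1))⁻¹ : ℝ) : ℂ) *
      conj (cellChar (mesh (4 * a) (2 * n + 1)) ξ)) atTop (𝓝 1) := by
    have h := (Complex.continuous_conj.tendsto 1).comp (tendsto_inv_mul_cellChar a ξ ha)
    rw [map_one] at h
    refine h.congr fun n => ?_
    simp only [Function.comp_apply, map_mul, Complex.conj_ofReal]
  -- assemble in `ℂ`
  have hprod := (hC.mul (hS.const_mul (cexp (↑(2 * π * (2 * a * ξ)) * I))))
  have hlim : (1 : ℂ) * (cexp (↑(2 * π * (2 * a * ξ)) * I) * 𝓕 ks ξ) = 𝓕 k ξ := by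
    rw [hks, fourier_comp_sub, one_mul, ← mul_assoc, ← Complex.exp_add]
    have e : (↑(2 * π * (2 * a * ξ)) * I + ↑(2 * π * (-(2 * a * ξ))) * I : ℂ) = 0 := by
      push_cast; ring
    rw [e, Complex.exp_zero, one_mul]
  rw [hlim] at hprod
  have hcplx : Tendsto (fun n => (((‖𝓕 (latticeStep (mesh (4 * a) (2 * n + 1)) (q n)) ξ‖ ^ 2 : ℝ)) : ℂ))
      atTop (𝓝 (𝓕 k ξ)) := by
    refine hprod.congr fun n => ?_
    rw [ofReal_norm_sq_fourier_latticeStep (mesh_pos h4 _) n (hq n) (hPq n) ξ, hZ n]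
  have hre := (Complex.continuous_re.tendsto _).comp hcplx
  exact hre.congr fun n => by simp only [Function.comp_apply, Complex.ofReal_re]

end Literature.Analysis.Fourier.BoasKacNonneg

end
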